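import Literature.NumberTheory.LFunctions.Zhang2022.Section8Lemma84Model
import Literature.Analysis.Complex.RectangleContourTools
import HarnessLib

/-!
# Zhang (2022), Lemma 8.4 — VII: the small rectangle around the two poles, integrand versus model

Topic `Literature/NumberTheory/LFunctions/Zhang2022` (Landau–Siegel audit tree; verdict-neutral).
Y. Zhang, *Discrete mean estimates and the Landau–Siegel zero*, arXiv:2211.02515v1 (2022)
[Zhang2022LandauSiegel] — **an unrefereed manuscript under adjudication**; DAG node `Z22:Lem8.4.pf`
[Z22 p.47, tex L2405–2418]: "Combining these results with Lemma 8.3, we find that the integral (8.9)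
is equal to `L′(1,χ)Π(d,r)·(2πi)⁻¹∮_{|s|=5α} (s+β_{j+1})(s+β_{j+2})x^s/(s(s+β_μ)²) ds + O(𝓛⁻⁶)`.
The result now follows by direct calculation."

In the variable `u = s + β_μ` the integrand of (8.9) is `G(u) = e^{uL}Φ(u)/u²` and the model is
`G₀(u) = M₀e^{uL}(u + β_a − β_μ)(u + β_b − β_μ)/((u − β_μ)u²)` (`M₀ = L′(1,χ)Π(d,r)`, file
`Section8Lemma84Model`). This file PROVES the generic comparison on the small rectangle
`R_s = [−α/2, α/2] × [Im β_μ − 3α, Im β_μ + 3α]` (which replaces the manuscript's circle `|s| = 5α`;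
both poles `0`, `β_μ` of `G₀` lie inside): if `‖Φ(u) − M₀(u+β_a−β_μ)(u+β_b−β_μ)/(u−β_μ)‖ ≤ Δ` on
`∂R_s`, then `‖∮_{∂R_s} G − 2πi·M₀e^{β_μL}𝔤(β_a,β_b,β_μ;L)‖ ≤ 56e^{αL/2}Δ/α`
(`norm_rectSmall_sub_main_le`: the model's boundary integral is `2πi·M₀e^{β_μL}𝔤` by
`rectBoundaryIntegral_modelG`; on `∂R_s`, `|u| ≥ α/2`, `Re u ≤ α/2`; perimeter `14α`).

Nothing about the manuscript's Theorems 1–2 or about Landau–Siegel zeros is asserted.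

## References

* Y. Zhang, arXiv:2211.02515v1 (2022), §8 Lemma 8.4 (proof, last two displays).
  [cite: Zhang2022LandauSiegel, §8 Lemma 8.4]
* J. B. Conway, *Functions of One Complex Variable I*, GTM 11, Ch. V §2 Thm 2.2. [cite: Conway1978, V.2.2]
-/

noncomputable section

open Complex Real Set MeasureTheory Filter Topology

namespace Literature.NumberTheory.LFunctions.Zhang2022.Lemma84

open Literature.Analysis.Complex

section SmallRect

variable {Φ G : ℂ → ℂ} {M₀ βa βb βμ : ℂ} {L α Δ : ℝ}

/-- Real and imaginary part of the boundary parametrisation `x + iy`. [folklore] -/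
private theorem re_im_pt (x y : ℝ) : ((x : ℂ) + y * I).re = x ∧ ((x : ℂ) + y * I).im = y := by
  constructor <;> simp

/-- **Geometry of `∂R_s`**: a boundary point `u` of `R_s = [−α/2, α/2] × [Im β_μ − 3α, Im β_μ + 3α]`
(`3α/2 ≤ Im β_μ ≤ 5α/2`, `Re β_μ = 0`) has `|u| ≥ α/2`, `Re u ≤ α/2`, `u ≠ 0`, `u ≠ β_μ`.
[cite: Zhang2022LandauSiegel, §8 Lemma 8.4 (proof)] -/
theorem bdry_facts (hα : 0 < α) (hβμre : βμ.re = 0) (hβμ1 : 3 * α / 2 ≤ βμ.im)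
    (hβμ2 : βμ.im ≤ 5 * α / 2) {u : ℂ} (hre : u.re ∈ Icc (-(α / 2)) (α / 2))
    (hbd : |u.re| = α / 2 ∨ |u.im - βμ.im| = 3 * α) :
    α / 2 ≤ ‖u‖ ∧ u.re ≤ α / 2 ∧ u ≠ 0 ∧ u ≠ βμ := by
  have hnorm : α / 2 ≤ ‖u‖ := by
    rcases hbd with h | h
    · calc α / 2 = |u.re| := h.symm
        _ ≤ ‖u‖ := Complex.abs_re_le_norm u
    · have him : α / 2 ≤ |u.im| := by
        rcases (abs_eq (by positivity : (0 : ℝ) ≤ 3 * α)).1 h with h' | h'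
        · rw [abs_of_pos (by linarith)]; linarith
        · rw [abs_of_neg (by linarith)]; linarith
      exact him.trans (Complex.abs_im_le_norm u)
  refine ⟨hnorm, hre.2, ?_, ?_⟩
  · intro h0
    rw [h0, norm_zero] at hnorm
    linarith
  · intro hμ
    rcases hbd with h | h
    · rw [hμ, hβμre, abs_zero] at h
      linarith
    · rw [hμ, sub_self, abs_zero] at h
      linarith

/-- **The small rectangle: integrand versus model.** Let `G(u) = e^{uL}Φ(u)/u²` (`L ≥ 0`, `α > 0`),
`3α/2 ≤ Im β_μ ≤ 5α/2`, `Re β_μ = 0`, and suppose that at every boundary point `u` of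
`R_s = [−α/2, α/2] × [Im β_μ − 3α, Im β_μ + 3α]` the function `G` is continuous and
`‖Φ(u) − M₀(u+β_a−β_μ)(u+β_b−β_μ)/(u−β_μ)‖ ≤ Δ`. Then
`‖∮_{∂R_s} G − 2πi·M₀e^{β_μL}𝔤(β_a,β_b,β_μ;L)‖ ≤ 56·e^{αL/2}·Δ/α` — the model's boundary integral is
exactly `2πi·M₀e^{β_μL}𝔤` ("direct calculation", `rectBoundaryIntegral_modelG`), and on `∂R_s` one has
`‖G − G₀‖ ≤ e^{αL/2}Δ·4/α²`, perimeter `14α`. [cite: Zhang2022LandauSiegel, §8 Lemma 8.4 (proof)]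
[cite: Conway1978, V.2.2] -/
theorem norm_rectSmall_sub_main_le (hα : 0 < α) (hL : 0 ≤ L) (hβμre : βμ.re = 0)
    (hβμ1 : 3 * α / 2 ≤ βμ.im) (hβμ2 : βμ.im ≤ 5 * α / 2)
    (hG : ∀ u, G u = cexp (u * (L : ℂ)) * Φ u / u ^ 2)
    (hΔ : ∀ u : ℂ, u.re ∈ Icc (-(α / 2)) (α / 2) → u.im ∈ Icc (βμ.im - 3 * α) (βμ.im + 3 * α) →
      (|u.re| = α / 2 ∨ |u.im - βμ.im| = 3 * α) →
      ‖Φ u - M₀ * (u + (βa - βμ)) * (u + (βb - βμ)) / (u - βμ)‖ ≤ Δ)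
    (hGc : ∀ u : ℂ, u.re ∈ Icc (-(α / 2)) (α / 2) → u.im ∈ Icc (βμ.im - 3 * α) (βμ.im + 3 * α) →
      (|u.re| = α / 2 ∨ |u.im - βμ.im| = 3 * α) → ContinuousAt G u) :
    ‖rectBoundaryIntegral G (-(α / 2)) (α / 2) (βμ.im - 3 * α) (βμ.im + 3 * α) -
        2 * π * I * (M₀ * cexp (βμ * (L : ℂ)) * frakg βa βb βμ (L : ℂ))‖ ≤
      56 * Real.exp (α * L / 2) * Δ / α := by
  -- the model integrand and its boundary integral
  set G₀ : ℂ → ℂ := fun u : ℂ => M₀ * cexp (u * (L : ℂ)) * ((u + (βa - βμ)) * (u + (βb - βμ))) /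
    ((u - βμ) * u ^ 2) with hG₀
  have hab : -(α / 2) < α / 2 := by linarith
  have hcd : βμ.im - 3 * α < βμ.im + 3 * α := by linarith
  have hμ0 : βμ ≠ 0 := by
    intro h; rw [h] at hβμ1; simp at hβμ1; linarith
  have h0in : (0 : ℂ) ∈ Ioo (-(α / 2)) (α / 2) ×ℂ Ioo (βμ.im - 3 * α) (βμ.im + 3 * α) := by
    refine ⟨⟨?_, ?_⟩, ?_, ?_⟩ <;> simp only [Complex.zero_re, Complex.zero_im] <;> linarith
  have hμin : βμ ∈ Ioo (-(α / 2)) (α / 2) ×ℂ Ioo (βμ.im - 3 * α) (βμ.im + 3 * α) := by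
    refine ⟨⟨?_, ?_⟩, ?_, ?_⟩
    · rw [hβμre]; linarith
    · rw [hβμre]; linarith
    · linarith
    · linarith
  have hmodel : rectBoundaryIntegral G₀ (-(α / 2)) (α / 2) (βμ.im - 3 * α) (βμ.im + 3 * α) =
      2 * π * I * (M₀ * cexp (βμ * (L : ℂ)) * frakg βa βb βμ (L : ℂ)) :=
    rectBoundaryIntegral_modelG M₀ βa βb βμ (L : ℂ) hab hcd h0in hμin hμ0
  -- the difference on the boundary
  set F : ℂ → ℂ := fun u => G u - G₀ u with hF
  set Mb : ℝ := Real.exp (α * L / 2) * (4 / α ^ 2) * Δ with hMb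
  have hbd : ∀ u : ℂ, u.re ∈ Icc (-(α / 2)) (α / 2) →
      u.im ∈ Icc (βμ.im - 3 * α) (βμ.im + 3 * α) → (|u.re| = α / 2 ∨ |u.im - βμ.im| = 3 * α) →
      ‖F u‖ ≤ Mb ∧ ContinuousAt F u ∧ ContinuousAt G₀ u := by
    intro u hre him hb
    obtain ⟨hnorm, hre2, hu0, huμ⟩ := bdry_facts hα hβμre hβμ1 hβμ2 hre hb
    have huμ' : u - βμ ≠ 0 := sub_ne_zero.2 huμ
    have hu2 : u ^ 2 ≠ 0 := pow_ne_zero 2 hu0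
    have hG₀c : ContinuousAt G₀ u := (differentiableAt_modelG M₀ βa βb βμ (L : ℂ) hu0 huμ).continuousAt
    refine ⟨?_, (hGc u hre him hb).sub hG₀c, hG₀c⟩
    have hFu : F u = cexp (u * (L : ℂ)) / u ^ 2 *
        (Φ u - M₀ * (u + (βa - βμ)) * (u + (βb - βμ)) / (u - βμ)) := by
      simp only [hF, hG₀, hG u]
      field_simp
    have hexp : ‖cexp (u * (L : ℂ))‖ ≤ Real.exp (α * L / 2) := by
      rw [Complex.norm_exp]
      have : (u * (L : ℂ)).re = u.re * L := by simp [Complex.mul_re]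
      rw [this, Real.exp_le_exp]
      calc u.re * L ≤ α / 2 * L := mul_le_mul_of_nonneg_right hre2 hL
        _ = α * L / 2 := by ring
    have husq : (α / 2) ^ 2 ≤ ‖u ^ 2‖ := by
      rw [norm_pow]; exact pow_le_pow_left₀ (by positivity) hnorm 2
    have hΔu := hΔ u hre him hb
    rw [hFu, norm_mul, norm_div]
    calc ‖cexp (u * (L : ℂ))‖ / ‖u ^ 2‖ * ‖Φ u - M₀ * (u + (βa - βμ)) * (u + (βb - βμ)) / (u - βμ)‖
        ≤ Real.exp (α * L / 2) / (α / 2) ^ 2 * Δ := by gcongr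
      _ = Mb := by rw [hMb]; field_simp; ring
  -- boundary points of the four sides
  have hbot : ∀ x ∈ Icc (-(α / 2)) (α / 2),
      ((x : ℂ) + (βμ.im - 3 * α : ℝ) * I).re ∈ Icc (-(α / 2)) (α / 2) ∧
      ((x : ℂ) + (βμ.im - 3 * α : ℝ) * I).im ∈ Icc (βμ.im - 3 * α) (βμ.im + 3 * α) ∧
      (|((x : ℂ) + (βμ.im - 3 * α : ℝ) * I).re| = α / 2 ∨
        |((x : ℂ) + (βμ.im - 3 * α : ℝ) * I).im - βμ.im| = 3 * α) := by
    intro x hx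
    obtain ⟨h1, h2⟩ := re_im_pt x (βμ.im - 3 * α)
    rw [h1, h2]
    refine ⟨hx, ⟨le_rfl, by linarith⟩, Or.inr ?_⟩
    rw [show βμ.im - 3 * α - βμ.im = -(3 * α) by ring, abs_neg, abs_of_pos (by positivity)]
  have htop : ∀ x ∈ Icc (-(α / 2)) (α / 2),
      ((x : ℂ) + (βμ.im + 3 * α : ℝ) * I).re ∈ Icc (-(α / 2)) (α / 2) ∧
      ((x : ℂ) + (βμ.im + 3 * α : ℝ) * I).im ∈ Icc (βμ.im - 3 * α) (βμ.im + 3 * α) ∧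
      (|((x : ℂ) + (βμ.im + 3 * α : ℝ) * I).re| = α / 2 ∨
        |((x : ℂ) + (βμ.im + 3 * α : ℝ) * I).im - βμ.im| = 3 * α) := by
    intro x hx
    obtain ⟨h1, h2⟩ := re_im_pt x (βμ.im + 3 * α)
    rw [h1, h2]
    refine ⟨hx, ⟨by linarith, le_rfl⟩, Or.inr ?_⟩
    rw [show βμ.im + 3 * α - βμ.im = 3 * α by ring, abs_of_pos (by positivity)]
  have hleft : ∀ y ∈ Icc (βμ.im - 3 * α) (βμ.im + 3 * α),
      (((-(α / 2) : ℝ) : ℂ) + y * I).re ∈ Icc (-(α / 2)) (α / 2) ∧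
      (((-(α / 2) : ℝ) : ℂ) + y * I).im ∈ Icc (βμ.im - 3 * α) (βμ.im + 3 * α) ∧
      (|(((-(α / 2) : ℝ) : ℂ) + y * I).re| = α / 2 ∨
        |(((-(α / 2) : ℝ) : ℂ) + y * I).im - βμ.im| = 3 * α) := by
    intro y hy
    obtain ⟨h1, h2⟩ := re_im_pt (-(α / 2)) y
    rw [h1, h2]
    refine ⟨⟨le_rfl, by linarith⟩, hy, Or.inl ?_⟩
    rw [abs_neg, abs_of_pos (by positivity)]
  have hright : ∀ y ∈ Icc (βμ.im - 3 * α) (βμ.im + 3 * α),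
      (((α / 2 : ℝ) : ℂ) + y * I).re ∈ Icc (-(α / 2)) (α / 2) ∧
      (((α / 2 : ℝ) : ℂ) + y * I).im ∈ Icc (βμ.im - 3 * α) (βμ.im + 3 * α) ∧
      (|(((α / 2 : ℝ) : ℂ) + y * I).re| = α / 2 ∨
        |(((α / 2 : ℝ) : ℂ) + y * I).im - βμ.im| = 3 * α) := by
    intro y hy
    obtain ⟨h1, h2⟩ := re_im_pt (α / 2) y
    rw [h1, h2]
    refine ⟨⟨by linarith, le_rfl⟩, hy, Or.inl ?_⟩
    rw [abs_of_pos (by positivity)]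
  -- `∮ G = ∮ F + ∮ G₀`
  have hsplit : rectBoundaryIntegral G (-(α / 2)) (α / 2) (βμ.im - 3 * α) (βμ.im + 3 * α) =
      rectBoundaryIntegral F (-(α / 2)) (α / 2) (βμ.im - 3 * α) (βμ.im + 3 * α) +
        rectBoundaryIntegral G₀ (-(α / 2)) (α / 2) (βμ.im - 3 * α) (βμ.im + 3 * α) := by
    have h := rectBoundaryIntegral_add (F := F) (G := G₀) hab.le hcd.le
      (fun x hx => (hbd _ (hbot x hx).1 (hbot x hx).2.1 (hbot x hx).2.2).2.1)
      (fun x hx => (hbd _ (htop x hx).1 (htop x hx).2.1 (htop x hx).2.2).2.1)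
      (fun y hy => (hbd _ (hleft y hy).1 (hleft y hy).2.1 (hleft y hy).2.2).2.1)
      (fun y hy => (hbd _ (hright y hy).1 (hright y hy).2.1 (hright y hy).2.2).2.1)
      (fun x hx => (hbd _ (hbot x hx).1 (hbot x hx).2.1 (hbot x hx).2.2).2.2)
      (fun x hx => (hbd _ (htop x hx).1 (htop x hx).2.1 (htop x hx).2.2).2.2)
      (fun y hy => (hbd _ (hleft y hy).1 (hleft y hy).2.1 (hleft y hy).2.2).2.2)
      (fun y hy => (hbd _ (hright y hy).1 (hright y hy).2.1 (hright y hy).2.2).2.2)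
    have he : (fun z => F z + G₀ z) = G := by
      funext z; simp only [hF, sub_add_cancel]
    rw [he] at h
    exact h
  -- the perimeter bound for `F`
  have hper := norm_rectBoundaryIntegral_le (F := F) hab.le hcd.le (M := Mb)
    (fun x hx => (hbd _ (hbot x hx).1 (hbot x hx).2.1 (hbot x hx).2.2).1)
    (fun x hx => (hbd _ (htop x hx).1 (htop x hx).2.1 (htop x hx).2.2).1)
    (fun y hy => (hbd _ (hleft y hy).1 (hleft y hy).2.1 (hleft y hy).2.2).1)
    (fun y hy => (hbd _ (hright y hy).1 (hright y hy).2.1 (hright y hy).2.2).1)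
  rw [hsplit, hmodel, add_sub_cancel_right]
  refine hper.trans (le_of_eq ?_)
  rw [hMb]
  field_simp
  ring

end SmallRect

end Literature.NumberTheory.LFunctions.Zhang2022.Lemma84
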